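import Mathlib
import HarnessLib
import Summits.HubbardSuperconductivity.HubbardSuperconductivity.Theses.ChiralWindow
import Summits.HubbardSuperconductivity.HubbardSuperconductivity.Theorems.ChiralWindowCwKLChiralWindowReductionHS
import Summits.HubbardSuperconductivity.HubbardSuperconductivity.Theorems.ChiralWindowCwKLChiralWindowLindhardD4
import Summits.HubbardSuperconductivity.HubbardSuperconductivity.Theorems.ChiralWindowCwKLChiralWindowRotPartner
import Summits.HubbardSuperconductivity.HubbardSuperconductivity.Theorems.ChiralWindowCwKLChiralWindowKernelOp
import Summits.HubbardSuperconductivity.HubbardSuperconductivity.Theorems.ChiralWindowCwKLChiralWindowD4Unitary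
import Summits.HubbardSuperconductivity.HubbardSuperconductivity.Theorems.ChiralWindowCwKLChiralWindowSectorProj
import Summits.HubbardSuperconductivity.HubbardSuperconductivity.Theorems.ChiralWindowCwKLChiralWindowBottomStates
import Summits.HubbardSuperconductivity.HubbardSuperconductivity.Theorems.ChiralWindowCwKLChiralWindowWindowBridge
import Summits.HubbardSuperconductivity.HubbardSuperconductivity.Theorems.ChiralWindowCwKLChiralWindowKernelHS
import Summits.HubbardSuperconductivity.HubbardSuperconductivity.Theorems.ChiralWindowCwKLChiralWindowChannelOps
import Summits.HubbardSuperconductivity.HubbardSuperconductivity.Theorems.ChiralWindowCwKLChiralWindowCertNumerical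

/-!
# Crux `CwKLChiralWindow` (stmt-1741), line `Sketch`: the crux from an accepted, certified record

`cwKLChiralWindow_of_klCert : ∀ c : KLCert, c.check = true → c.Enclosures → CwKLChiralWindow` — the END of the Lean side of
the certificate: given ANY rational record accepted by the kernel-decidable checker `KLCert.check`
(`Theorems/ChiralWindowDefs.lean`) whose enclosures E0–E6 hold (`KLCert.Enclosures`, the named numerical hypothesis certified
by interval arithmetic, `Cruxes/CwKLChiralWindow/CertInterface.md`), the crux follows: soundness `stub_klCertNumerical`
(p127923) gives the `μ`-form clauses N0–N5 on `[c.mub, c.mua]`; the window bridge `a = 1 - n(μ_a)`, `b = 1 - n(μ_b)`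
(`stub_klWindowBridge`), bottom states from the landed operator package (`stub_klKernelOp`, `stub_klD4Unitary`,
`stub_klSectorProj`, `stub_klBottomStates`), the rotate of the `E` state (`stub_klRotPartner`) and
`cwKLChiralWindow_of_certificateHS` (p103087) assemble `CwKLChiralWindow` with witness `χs = E`, `γ = c.gamma`, `c = c.cov`,
`U₁ = 1`.  What remains for the crux is the computation: a concrete record `klCert` with `klCert.check = true` (by `decide`)
and `klCert.Enclosures` (certified enclosures, `ccert` seat).
-/

noncomputable section

set_option linter.dupNamespace false

namespace Summit.HubbardSuperconductivity.HubbardSuperconductivity.Theorems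

open MeasureTheory Literature.MathematicalPhysics.QuantumLattice CwKLChiralWindow
open Summit.HubbardSuperconductivity.HubbardSuperconductivity.Theses.ChiralWindow

/-- The Lindhard kernel `χ₀(k + k')` is `D₄`-invariant in both variables jointly. [folklore] -/
theorem klc6_kernel_invariant (μ : ℝ) (g : DihedralGroup 4) (k k' : Momentum) :
    lindhardFunction (squareDispersion 1 0) μ (d4Momentum g k + d4Momentum g k') =
      lindhardFunction (squareDispersion 1 0) μ (k + k') := by
  rw [← kl_co_d4Momentum_add, stub_klLindhardD4]

/-- **Bottom states exist** in every channel `χ ≠ A1g` with negative bottom, `μ ∈ (-4,0)` (operator package of the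
landed stubs + `stub_klBottomStates`). [folklore] -/
theorem klc6_exists_bottomState {μ : ℝ} (hμ : μ ∈ Set.Ioo (-4 : ℝ) 0) (χ : D4Irrep) (hχ : χ ≠ D4Irrep.A1g)
    (hneg : channelInf (squareDispersion 1 0) μ 1 χ < 0) :
    ∃ ψ : Momentum → ℝ, IsChannelState (squareDispersion 1 0) μ χ ψ ∧
      pairingForm (squareDispersion 1 0) μ 1 ψ = channelInf (squareDispersion 1 0) μ 1 χ := by
  have hK2 : MemLp (Function.uncurry fun k k' : Momentum => lindhardFunction (squareDispersion 1 0) μ (k + k')) 2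
      ((fermiCurveMeasure (squareDispersion 1 0) μ).prod (fermiCurveMeasure (squareDispersion 1 0) μ)) :=
    stub_klKernelHS μ hμ
  obtain ⟨⟨A, hA⟩, hAprops⟩ := stub_klKernelOp μ hμ (fun k k' => lindhardFunction (squareDispersion 1 0) μ (k + k')) hK2
  obtain ⟨hAc, hAsa', -, hAinner⟩ := hAprops A hA
  have hAsa : IsSelfAdjoint A := hAsa' fun k k' => by rw [add_comm]
  obtain ⟨U, hUae, -, hU1, hUmul, -, hUadj, hUcomm⟩ := stub_klD4Unitary μ hμ
  have hAU : ∀ g : DihedralGroup 4, A * U g = U g * A :=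
    hUcomm (fun k k' => lindhardFunction (squareDispersion 1 0) μ (k + k')) A
      (fun g k k' => klc6_kernel_invariant μ g k k') hK2 hA
  obtain ⟨P, hPdef, -, hPP, hPsa, -, hPfix, hPrepr, -⟩ := stub_klSectorProj μ hμ U hUae hU1 hUmul hUadj χ
  have hAP : A * P = P * A := by
    rw [hPdef, mul_smul_comm, smul_mul_assoc, Finset.mul_sum, Finset.sum_mul]
    congr 1
    refine Finset.sum_congr rfl fun g _ => ?_
    rw [mul_smul_comm, smul_mul_assoc, hAU g]
  exact (stub_klBottomStates μ hμ χ A P hχ hA hAinner hAsa hAc hPP hPsa hAP hPfix hPrepr hneg).1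

/-- Clause (iv) at a window level `μ ∈ (-4,0)`: a `B1g` bottom state `g`, an `E` bottom state `f₀` with its rotate,
given negativity of the two bottoms and the node-covering inequality for all bottom states. [folklore] -/
theorem klc6_nodeCover_at {μ : ℝ} (hμ : μ ∈ Set.Ioo (-4 : ℝ) 0) {cov : ℝ}
    (hnegB : channelInf (squareDispersion 1 0) μ 1 D4Irrep.B1g < 0)
    (hnegE : channelInf (squareDispersion 1 0) μ 1 D4Irrep.E < 0)
    (hcov : ∀ g f : Momentum → ℝ,
      IsChannelState (squareDispersion 1 0) μ D4Irrep.B1g g →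
      pairingForm (squareDispersion 1 0) μ 1 g = channelInf (squareDispersion 1 0) μ 1 D4Irrep.B1g →
      IsChannelState (squareDispersion 1 0) μ D4Irrep.E f →
      pairingForm (squareDispersion 1 0) μ 1 f = channelInf (squareDispersion 1 0) μ 1 D4Irrep.E →
      ∀ᵐ k ∂fermiCurveMeasure (squareDispersion 1 0) μ, cov ≤ g k ^ 2 + (f k ^ 2 + f (rotMomentum k) ^ 2)) :
    ∃ (g : Momentum → ℝ) (n : ℕ) (f : Fin n → Momentum → ℝ),
      IsChannelState (squareDispersion 1 0) μ D4Irrep.B1g g ∧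
      pairingForm (squareDispersion 1 0) μ 1 g = channelInf (squareDispersion 1 0) μ 1 D4Irrep.B1g ∧
      (∀ i, IsChannelState (squareDispersion 1 0) μ D4Irrep.E (f i) ∧
        pairingForm (squareDispersion 1 0) μ 1 (f i) = channelInf (squareDispersion 1 0) μ 1 D4Irrep.E) ∧
      (Pairwise fun i j => ∫ k, f i k * f j k ∂fermiCurveMeasure (squareDispersion 1 0) μ = 0) ∧
      ∀ᵐ k ∂fermiCurveMeasure (squareDispersion 1 0) μ, cov ≤ g k ^ 2 + ∑ i, f i k ^ 2 := by
  obtain ⟨g, hg, hgv⟩ := klc6_exists_bottomState hμ D4Irrep.B1g (by decide) hnegB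
  obtain ⟨f₀, hf, hfv⟩ := klc6_exists_bottomState hμ D4Irrep.E (by decide) hnegE
  have hrotχ : ∀ (μ : ℝ) (q : Momentum),
      lindhardFunction (squareDispersion 1 0) μ (rotMomentum q) = lindhardFunction (squareDispersion 1 0) μ q :=
    fun μ q => stub_klLindhardD4 μ (DihedralGroup.r 1) q
  obtain ⟨hf', hfv', horth⟩ := stub_klRotPartner hrotχ _ hμ f₀ hf
  have hcov' := hcov g f₀ hg hgv hf hfv
  refine ⟨g, 2, ![f₀, f₀ ∘ rotMomentum], hg, hgv, ?_, ?_, ?_⟩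
  · intro i
    fin_cases i
    · exact ⟨hf, hfv⟩
    · change IsChannelState (squareDispersion 1 0) _ D4Irrep.E (f₀ ∘ rotMomentum) ∧
        pairingForm (squareDispersion 1 0) _ 1 (f₀ ∘ rotMomentum) = _
      exact ⟨hf', by rw [hfv' 1]; exact hfv⟩
  · intro i j hij
    fin_cases i <;> fin_cases j
    · exact absurd rfl hij
    · simpa using horth
    · simp only [Fin.mk_one, Fin.isValue, Matrix.cons_val_one, Matrix.cons_val_fin_one, Function.comp_apply,
        Fin.zero_eta, Matrix.cons_val_zero]
      simp_rw [mul_comm (f₀ (rotMomentum _)) (f₀ _)]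
      exact horth
    · exact absurd rfl hij
  · filter_upwards [hcov'] with k hk
    simpa [Fin.sum_univ_two] using hk

/-- **The crux from an accepted record with certified enclosures** (`cwKLChiralWindow_of_klCert`): witness `χs = E`,
`a = 1 - n(c.mua)`, `b = 1 - n(c.mub)`, `γ = c.gamma`, `c = c.cov`, `U₁ = 1`. [folklore] -/
theorem cwKLChiralWindow_of_klCert : ∀ c : KLCert, c.check = true → c.Enclosures → CwKLChiralWindow := by
  intro c hc hE
  obtain ⟨⟨h4, hba, ha0, hγ, hcov0⟩, hN0a, hN0b, hN1, hN2, hN3, hN4, hN5⟩ := stub_klCertNumerical c hc hE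
  obtain ⟨hab, hμa, hμb, hwin⟩ := stub_klWindowBridge ((c.mua : ℚ) : ℝ) ((c.mub : ℚ) : ℝ) h4 hba ha0
  refine cwKLChiralWindow_of_certificateHS ⟨D4Irrep.E, by decide, by decide, by decide,
    1 - KohnLuttinger.filling (squareDispersion 1 0) ((c.mua : ℚ) : ℝ),
    1 - KohnLuttinger.filling (squareDispersion 1 0) ((c.mub : ℚ) : ℝ),
    ((c.gamma : ℚ) : ℝ), ((c.cov : ℚ) : ℝ), hN0a, hab, hN0b, hγ, hcov0, ?_, ?_, ?_, ?_⟩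
  · intro χ hχ
    rw [hμa]
    exact hN1 χ hχ
  · intro χ hχ
    rw [hμb]
    exact hN2 χ hχ
  · intro δ hδ χ h1 h2
    exact hN3 _ (hwin δ hδ).1 χ h1 h2
  · intro δ hδ
    obtain ⟨hμδ, -⟩ := hwin δ hδ
    have hμ' : chemicalPotentialOfDensity (squareDispersion 1 0) (1 - δ) ∈ Set.Ioo (-4 : ℝ) 0 :=
      ⟨by linarith [hμδ.1], by linarith [hμδ.2]⟩
    exact klc6_nodeCover_at hμ' (hN4 _ hμδ).1 (hN4 _ hμδ).2 (hN5 _ hμδ)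

end Summit.HubbardSuperconductivity.HubbardSuperconductivity.Theorems

end
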